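import Summits.ValiantsHypothesis.ValiantsHypothesis.Theorems.FeketeSOSFeketeSOSHardPaleyRIPIntervalFlat
import Mathlib.Analysis.Real.Sqrt
import Mathlib.NumberTheory.Harmonic.Bounds
import Mathlib.Algebra.BigOperators.Intervals
import Mathlib.Algebra.Order.BigOperators.Group.Finset

/-!
# Route FeketeSOS — crux `FeketeSOSHard` (stmt-ValiantsHypothesis-3996), line `paley-rip` v3,
# `stub_tameOperator` piece (B), sharpness: flat interval patterns cost `Ω(log k)` — so `Θ(log k)`

`…PaleyRIPIntervalFlat.lean` represents the all-ones pattern `Σ_{n<2k−1} X^n` by weighted squares supported in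
`[0,k)` at mass `≤ ⌊log₂ k⌋ + 5/2`.  Here the matching lower bound: EVERY such representation has mass
`≥ H_k/8 ≥ log(k+1)/8` (`flat_rep_mass_lower`, `flat_rep_mass_ge_log`).  The certificate is the dual weight
`z = 1/r_{[0,k)}` (`r(n) = min(n+1, 2k−1−n)` = number of ways to write `n` as a sum of two elements of `[0,k)`):

* pairing (`lz_C_mul_X_pow`, `lz_sq`, `lz_box`; exact, non-cyclic analogue of `…PaleyRIPPairing`):
  `Σ_j c_j · w_jᵀ H(z) w_j = Σ_{n<2k−1} z(n) = Σ_n 1/r(n) ≥ H_k`;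
* `hankel_inv_repr_norm_le`: `|wᵀ H(z) w| ≤ 8‖w‖₂²` — `H(z)` is entrywise dominated by a Hilbert matrix
  `1/(a+b+1)` plus its reflection `1/(2k−1−a−b)`, and each has Schur norm `≤ 4` (`hilbert_schur`, via the
  weights `√(a+1)` and the elementary row estimate `hilbertRow_le_four`: `Σ_b √(a+1)/((a+b+1)√(b+1)) ≤ 4`,
  from the telescoping bounds `sum_inv_sqrt_le`, `sum_Ico_inv_three_halves_le`).

(The sharp constants — Hilbert's `π` and `max` instead of the sum of the two pieces — would give
`≥ (ln k)/π − O(1)`; `8` is what the elementary Schur test yields.)  Consequence for the census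
(`Cruxes/FeketeSOSHard/Lines/paley-rip-stub3-census.md` §5): the logarithm the "R-trick" pays per flat block is
intrinsic, not an artefact of the preimage chosen.

Honest framing (rung currency): Theorems-side helper `--supports` stmt-3996; nothing closes; `stub_tameOperator`
(r ≥ 2), `stub_paleyFlatRIP` and the crux stay OPEN; `VP ≠ VNP` is untouched.
-/

set_option linter.dupNamespace false

namespace Summit.ValiantsHypothesis.ValiantsHypothesis.Theorems.FeketeSOSHardPaleyRIP

open Polynomial Finset
open scoped BigOperators

noncomputable section

/-! ## Elementary Schur-test estimates for the Hilbert kernel `1/(a+b+1)` -/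

/-- `Σ_{b≤a} 1/√(b+1) ≤ 2√(a+1)` (telescoping `1/√(b+1) ≤ 2(√(b+1) − √b)`; cf. the same estimate in
`Literature.…Balaban1983to89.T4OneLoopAsymptotics`, not imported here to keep the Valiant tree light). [folklore] -/
theorem sum_inv_sqrt_le (a : ℕ) :
    (∑ b ∈ range (a + 1), 1 / Real.sqrt ((b : ℝ) + 1)) ≤ 2 * Real.sqrt ((a : ℝ) + 1) := by
  -- the telescoping step, for every real `y ≥ 0`: `1/√(y+1) ≤ 2(√(y+1) − √y)`
  have step : ∀ y : ℝ, 0 ≤ y → 1 / Real.sqrt (y + 1) ≤ 2 * (Real.sqrt (y + 1) - Real.sqrt y) := by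
    intro y hy
    have ht : 0 < Real.sqrt (y + 1) := Real.sqrt_pos.2 (by linarith)
    have ht2 : Real.sqrt (y + 1) ^ 2 = y + 1 := Real.sq_sqrt (by linarith)
    have hs2 : Real.sqrt y ^ 2 = y := Real.sq_sqrt hy
    rw [div_le_iff₀ ht]
    nlinarith [sq_nonneg (Real.sqrt (y + 1) - Real.sqrt y), Real.sqrt_nonneg y]
  induction a with
  | zero => norm_num
  | succ a ih =>
    rw [Finset.sum_range_succ]
    have h := step ((a : ℝ) + 1) (by positivity)
    push_cast
    linarith

/-- `1/((b+1)√(b+1)) ≤ 2/√b − 2/√(b+1)` for `b ≥ 1`. [folklore] -/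
theorem inv_three_halves_le (b : ℕ) (hb : 1 ≤ b) :
    1 / (((b : ℝ) + 1) * Real.sqrt ((b : ℝ) + 1)) ≤
      2 / Real.sqrt (b : ℝ) - 2 / Real.sqrt ((b : ℝ) + 1) := by
  have hb' : (0 : ℝ) < b := by exact_mod_cast hb
  have ht : 0 < Real.sqrt ((b : ℝ) + 1) := Real.sqrt_pos.2 (by positivity)
  have hs : 0 < Real.sqrt (b : ℝ) := Real.sqrt_pos.2 hb'
  have ht2 : Real.sqrt ((b : ℝ) + 1) ^ 2 = (b : ℝ) + 1 := Real.sq_sqrt (by positivity)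
  have hs2 : Real.sqrt (b : ℝ) ^ 2 = (b : ℝ) := Real.sq_sqrt hb'.le
  have hst : Real.sqrt (b : ℝ) ≤ Real.sqrt ((b : ℝ) + 1) := Real.sqrt_le_sqrt (by linarith)
  rw [div_sub_div _ _ hs.ne' ht.ne', div_le_div_iff₀ (by positivity) (by positivity)]
  have key : 0 ≤ Real.sqrt ((b : ℝ) + 1) * (Real.sqrt ((b : ℝ) + 1) - Real.sqrt (b : ℝ)) ^ 2 :=
    mul_nonneg ht.le (sq_nonneg _)
  nlinarith [key, mul_pos hs ht, mul_pos (mul_pos hs ht) ht]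

/-- `Σ_{a<b<k} 1/((b+1)√(b+1)) ≤ 2/√(a+1)`. [folklore] -/
theorem sum_Ico_inv_three_halves_le (a k : ℕ) :
    (∑ b ∈ Finset.Ico (a + 1) k, 1 / (((b : ℝ) + 1) * Real.sqrt ((b : ℝ) + 1))) ≤
      2 / Real.sqrt ((a : ℝ) + 1) := by
  by_cases hk : a + 1 ≤ k
  · suffices h : (∑ b ∈ Finset.Ico (a + 1) k, 1 / (((b : ℝ) + 1) * Real.sqrt ((b : ℝ) + 1))) ≤
        2 / Real.sqrt ((a : ℝ) + 1) - 2 / Real.sqrt (k : ℝ) by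
      have : 0 ≤ 2 / Real.sqrt (k : ℝ) := by positivity
      linarith
    induction k, hk using Nat.le_induction with
    | base => simp
    | succ k hk ih =>
      rw [Finset.sum_Ico_succ_top hk]
      have h := inv_three_halves_le k (by omega)
      push_cast
      linarith
  · rw [Finset.Ico_eq_empty (by omega), Finset.sum_empty]
    positivity

/-- **Row sums of the weighted Hilbert kernel**: `Σ_{b<k} √(a+1)/((a+b+1)√(b+1)) ≤ 4`. [folklore] -/
theorem hilbertRow_le_four (a k : ℕ) :
    (∑ b ∈ range k, Real.sqrt ((a : ℝ) + 1) / (((a : ℝ) + b + 1) * Real.sqrt ((b : ℝ) + 1))) ≤ 4 := by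
  set g : ℕ → ℝ := fun b => Real.sqrt ((a : ℝ) + 1) / (((a : ℝ) + b + 1) * Real.sqrt ((b : ℝ) + 1)) with hg
  have hg0 : ∀ b, 0 ≤ g b := fun b => by positivity
  have hpa : 0 < Real.sqrt ((a : ℝ) + 1) := Real.sqrt_pos.2 (by positivity)
  -- enlarge the range to `max k (a+1)` and split at `a+1`
  have hsub : (∑ b ∈ range k, g b) ≤ ∑ b ∈ range (max k (a + 1)), g b :=
    Finset.sum_le_sum_of_subset_of_nonneg (Finset.range_mono (le_max_left _ _)) fun b _ _ => hg0 b
  rw [← Finset.sum_range_add_sum_Ico g (le_max_right k (a + 1))] at hsub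
  -- near part: `b ≤ a`
  have h1 : (∑ b ∈ range (a + 1), g b) ≤ 2 := by
    have hle : ∀ b ∈ range (a + 1), g b ≤ (1 / Real.sqrt ((a : ℝ) + 1)) * (1 / Real.sqrt ((b : ℝ) + 1)) := by
      intro b hb
      have hb' : (b : ℝ) ≤ a := by exact_mod_cast Nat.lt_succ_iff.1 (mem_range.1 hb)
      have hpb : 0 < Real.sqrt ((b : ℝ) + 1) := Real.sqrt_pos.2 (by positivity)
      have ha2 : Real.sqrt ((a : ℝ) + 1) ^ 2 = (a : ℝ) + 1 := Real.sq_sqrt (by positivity)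
      rw [hg, div_mul_div_comm, one_mul, div_le_div_iff₀ (by positivity) (by positivity)]
      nlinarith [mul_pos hpa hpb]
    refine (Finset.sum_le_sum hle).trans ?_
    rw [← Finset.mul_sum]
    have := sum_inv_sqrt_le a
    calc 1 / Real.sqrt ((a : ℝ) + 1) * ∑ b ∈ range (a + 1), 1 / Real.sqrt ((b : ℝ) + 1)
        ≤ 1 / Real.sqrt ((a : ℝ) + 1) * (2 * Real.sqrt ((a : ℝ) + 1)) :=
          mul_le_mul_of_nonneg_left this (by positivity)
      _ = 2 := by field_simp
  -- far part: `b > a`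
  have h2 : (∑ b ∈ Finset.Ico (a + 1) (max k (a + 1)), g b) ≤ 2 := by
    have hle : ∀ b ∈ Finset.Ico (a + 1) (max k (a + 1)),
        g b ≤ Real.sqrt ((a : ℝ) + 1) * (1 / (((b : ℝ) + 1) * Real.sqrt ((b : ℝ) + 1))) := by
      intro b hb
      have hb' : (a : ℝ) + 1 ≤ b := by exact_mod_cast (Finset.mem_Ico.1 hb).1
      have hpb : 0 < Real.sqrt ((b : ℝ) + 1) := Real.sqrt_pos.2 (by positivity)
      rw [hg, mul_one_div, div_le_div_iff₀ (by positivity) (by positivity)]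
      have ha0 : (0 : ℝ) ≤ a := Nat.cast_nonneg a
      nlinarith [mul_pos hpa hpb]
    refine (Finset.sum_le_sum hle).trans ?_
    rw [← Finset.mul_sum]
    calc Real.sqrt ((a : ℝ) + 1) * ∑ b ∈ Finset.Ico (a + 1) (max k (a + 1)),
          1 / (((b : ℝ) + 1) * Real.sqrt ((b : ℝ) + 1))
        ≤ Real.sqrt ((a : ℝ) + 1) * (2 / Real.sqrt ((a : ℝ) + 1)) :=
          mul_le_mul_of_nonneg_left (sum_Ico_inv_three_halves_le a _) hpa.le
      _ = 2 := by field_simp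
  linarith

/-- Weighted AM–GM: `x y ≤ (x² p/q + y² q/p)/2` for `p, q > 0`. [folklore] -/
theorem mul_le_weighted_amgm (x y p q : ℝ) (hp : 0 < p) (hq : 0 < q) :
    x * y ≤ (x ^ 2 * (p / q) + y ^ 2 * (q / p)) / 2 := by
  have h : x ^ 2 * (p / q) + y ^ 2 * (q / p) - 2 * (x * y) = (x * p - y * q) ^ 2 / (p * q) := by
    field_simp
    ring
  have h' : 0 ≤ (x * p - y * q) ^ 2 / (p * q) := by positivity
  linarith

/-- **Schur test for the finite Hilbert matrix** (constant `4`): for real `x`,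
`Σ_{a,b<k} x_a x_b/(a+b+1) ≤ 4 Σ_{a<k} x_a²`. [folklore] -/
theorem hilbert_schur (k : ℕ) (x : ℕ → ℝ) :
    (∑ a ∈ range k, ∑ b ∈ range k, x a * x b / ((a : ℝ) + b + 1)) ≤ 4 * ∑ a ∈ range k, x a ^ 2 := by
  have hp0 : ∀ a : ℕ, 0 < Real.sqrt ((a : ℝ) + 1) := fun a => Real.sqrt_pos.2 (by positivity)
  -- termwise weighted AM–GM
  have hle : ∀ a ∈ range k, ∀ b ∈ range k, x a * x b / ((a : ℝ) + b + 1) ≤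
      (x a ^ 2 * (Real.sqrt ((a : ℝ) + 1) / (((a : ℝ) + b + 1) * Real.sqrt ((b : ℝ) + 1)))) / 2 +
        (x b ^ 2 * (Real.sqrt ((b : ℝ) + 1) / (((b : ℝ) + a + 1) * Real.sqrt ((a : ℝ) + 1)))) / 2 := by
    intro a _ b _
    have hK : (0 : ℝ) < (a : ℝ) + b + 1 := by positivity
    have h := mul_le_weighted_amgm (x a) (x b) _ _ (hp0 a) (hp0 b)
    have h' : x a * x b / ((a : ℝ) + b + 1) ≤
        ((x a ^ 2 * (Real.sqrt ((a : ℝ) + 1) / Real.sqrt ((b : ℝ) + 1)) +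
          x b ^ 2 * (Real.sqrt ((b : ℝ) + 1) / Real.sqrt ((a : ℝ) + 1))) / 2) / ((a : ℝ) + b + 1) :=
      div_le_div_of_nonneg_right h hK.le
    refine h'.trans (le_of_eq ?_)
    rw [show ((b : ℝ) + a + 1) = ((a : ℝ) + b + 1) by ring]
    have ha := (hp0 a).ne'
    have hb := (hp0 b).ne'
    field_simp
  refine (Finset.sum_le_sum fun a ha => Finset.sum_le_sum fun b hb => hle a ha b hb).trans ?_
  rw [show (∑ a ∈ range k, ∑ b ∈ range k,
      ((x a ^ 2 * (Real.sqrt ((a : ℝ) + 1) / (((a : ℝ) + b + 1) * Real.sqrt ((b : ℝ) + 1)))) / 2 +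
        (x b ^ 2 * (Real.sqrt ((b : ℝ) + 1) / (((b : ℝ) + a + 1) * Real.sqrt ((a : ℝ) + 1)))) / 2))
      = (∑ a ∈ range k, ∑ b ∈ range k,
          (x a ^ 2 * (Real.sqrt ((a : ℝ) + 1) / (((a : ℝ) + b + 1) * Real.sqrt ((b : ℝ) + 1)))) / 2) +
        ∑ a ∈ range k, ∑ b ∈ range k,
          (x b ^ 2 * (Real.sqrt ((b : ℝ) + 1) / (((b : ℝ) + a + 1) * Real.sqrt ((a : ℝ) + 1)))) / 2 by
    rw [← Finset.sum_add_distrib]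
    exact Finset.sum_congr rfl fun a _ => Finset.sum_add_distrib]
  have hswap : (∑ a ∈ range k, ∑ b ∈ range k,
      (x b ^ 2 * (Real.sqrt ((b : ℝ) + 1) / (((b : ℝ) + a + 1) * Real.sqrt ((a : ℝ) + 1)))) / 2) =
      ∑ a ∈ range k, ∑ b ∈ range k,
        (x a ^ 2 * (Real.sqrt ((a : ℝ) + 1) / (((a : ℝ) + b + 1) * Real.sqrt ((b : ℝ) + 1)))) / 2 := by
    rw [Finset.sum_comm]
  rw [hswap]
  -- both halves are `Σ_a (x_a²/2) · (row sum at a) ≤ Σ_a 2 x_a²`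
  have hrow' : ∀ a ∈ range k,
      (∑ b ∈ range k, x a ^ 2 * (Real.sqrt ((a : ℝ) + 1) / (((a : ℝ) + b + 1) * Real.sqrt ((b : ℝ) + 1))) / 2)
        ≤ 2 * x a ^ 2 := by
    intro a _
    have hrow := hilbertRow_le_four a k
    have hx : 0 ≤ x a ^ 2 := sq_nonneg _
    have heq : (∑ b ∈ range k,
        x a ^ 2 * (Real.sqrt ((a : ℝ) + 1) / (((a : ℝ) + b + 1) * Real.sqrt ((b : ℝ) + 1))) / 2) =
        x a ^ 2 / 2 * ∑ b ∈ range k, Real.sqrt ((a : ℝ) + 1) / (((a : ℝ) + b + 1) * Real.sqrt ((b : ℝ) + 1)) := by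
      rw [Finset.mul_sum]
      exact Finset.sum_congr rfl fun b _ => by ring
    rw [heq]
    nlinarith [mul_le_mul_of_nonneg_left hrow hx]
  have h1 := Finset.sum_le_sum hrow'
  rw [← Finset.mul_sum] at h1
  linarith

/-- `1/min(p,q) ≤ 1/p + 1/q` for naturals (as reals). [folklore] -/
theorem inv_cast_min_le (p q : ℕ) : (((min p q : ℕ) : ℝ))⁻¹ ≤ ((p : ℝ))⁻¹ + ((q : ℝ))⁻¹ := by
  rcases le_total p q with h | h
  · rw [min_eq_left h]
    have : (0 : ℝ) ≤ ((q : ℝ))⁻¹ := by positivity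
    linarith
  · rw [min_eq_right h]
    have : (0 : ℝ) ≤ ((p : ℝ))⁻¹ := by positivity
    linarith

/-- **The Hankel form of `1/r_{[0,k)}` is bounded by `8‖w‖²`** (`r(n) = min(n+1, 2k−1−n)` = number of
representations of `n` as a sum of two elements of `[0,k)`): the two anti-triangular pieces are dominated
entrywise by a Hilbert matrix and its reflection, each of Schur norm `≤ 4`. [folklore] -/
theorem hankel_inv_repr_norm_le (k : ℕ) (w : ℕ → ℂ) :
    ‖∑ a ∈ range k, ∑ b ∈ range k,
        (((min (a + b + 1) (2 * k - 1 - (a + b)) : ℕ) : ℂ))⁻¹ * w a * w b‖ ≤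
      8 * ∑ a ∈ range k, ‖w a‖ ^ 2 := by
  -- triangle inequality and the entrywise bound `1/r ≤ 1/(a+b+1) + 1/(2k−1−a−b)`
  have h1 : ‖∑ a ∈ range k, ∑ b ∈ range k,
      (((min (a + b + 1) (2 * k - 1 - (a + b)) : ℕ) : ℂ))⁻¹ * w a * w b‖ ≤
      ∑ a ∈ range k, ∑ b ∈ range k,
        (‖w a‖ * ‖w b‖ / ((a : ℝ) + b + 1) + ‖w a‖ * ‖w b‖ / (((2 * k - 1 - (a + b) : ℕ) : ℝ))) := by
    refine (norm_sum_le _ _).trans (Finset.sum_le_sum fun a _ => (norm_sum_le _ _).trans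
      (Finset.sum_le_sum fun b _ => ?_))
    rw [norm_mul, norm_mul, norm_inv, Complex.norm_natCast]
    have hmin := inv_cast_min_le (a + b + 1) (2 * k - 1 - (a + b))
    have hw0 : 0 ≤ ‖w a‖ * ‖w b‖ := mul_nonneg (norm_nonneg _) (norm_nonneg _)
    have := mul_le_mul_of_nonneg_left hmin hw0
    push_cast at this ⊢
    rw [div_eq_mul_inv, div_eq_mul_inv]
    linarith
  refine h1.trans ?_
  rw [Finset.sum_congr rfl fun a _ => Finset.sum_add_distrib, Finset.sum_add_distrib]
  -- Hilbert piece
  have hA := hilbert_schur k (fun a => ‖w a‖)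
  -- reflected Hilbert piece
  have hrefl : (∑ a ∈ range k, ∑ b ∈ range k, ‖w a‖ * ‖w b‖ / (((2 * k - 1 - (a + b) : ℕ) : ℝ))) =
      ∑ a ∈ range k, ∑ b ∈ range k, ‖w (k - 1 - a)‖ * ‖w (k - 1 - b)‖ / ((a : ℝ) + b + 1) := by
    rw [← Finset.sum_range_reflect (fun a => ∑ b ∈ range k,
      ‖w a‖ * ‖w b‖ / (((2 * k - 1 - (a + b) : ℕ) : ℝ))) k]
    refine Finset.sum_congr rfl fun a ha => ?_
    rw [← Finset.sum_range_reflect (fun b => ‖w (k - 1 - a)‖ * ‖w b‖ / (((2 * k - 1 - ((k - 1 - a) + b) : ℕ) : ℝ))) k]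
    refine Finset.sum_congr rfl fun b hb => ?_
    have ha' := mem_range.1 ha
    have hb' := mem_range.1 hb
    have : 2 * k - 1 - ((k - 1 - a) + (k - 1 - b)) = a + b + 1 := by omega
    rw [this]
    push_cast
    ring
  have hB := hilbert_schur k (fun a => ‖w (k - 1 - a)‖)
  have hsq : (∑ a ∈ range k, ‖w (k - 1 - a)‖ ^ 2) = ∑ a ∈ range k, ‖w a‖ ^ 2 :=
    Finset.sum_range_reflect (fun a => ‖w a‖ ^ 2) k
  rw [hrefl]
  rw [hsq] at hB
  linarith

/-! ## Pairing with a weight `z : ℕ → ℂ` (exact, non-cyclic) -/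

/-- `L_z(c X^e) = z(e) c` for the coefficient functional `L_z = lsum (e ↦ z e • id)`. [folklore] -/
theorem lz_C_mul_X_pow (z : ℕ → ℂ) (c : ℂ) (e : ℕ) :
    (Polynomial.lsum (fun e : ℕ => (z e) • (LinearMap.id : ℂ →ₗ[ℂ] ℂ)) : ℂ[X] →ₗ[ℂ] ℂ) (C c * X ^ e) =
      z e * c := by
  rw [Polynomial.lsum_apply, Polynomial.C_mul_X_pow_eq_monomial, Polynomial.sum_monomial_index]
  · simp
  · simp

/-- `L_z(w²) = Σ_{a,b ∈ supp w} z(a+b) w_a w_b` (the Hankel form of `z`). [folklore] -/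
theorem lz_sq (z : ℕ → ℂ) (w : ℂ[X]) :
    (Polynomial.lsum (fun e : ℕ => (z e) • (LinearMap.id : ℂ →ₗ[ℂ] ℂ)) : ℂ[X] →ₗ[ℂ] ℂ) (w ^ 2) =
      ∑ a ∈ w.support, ∑ b ∈ w.support, z (a + b) * w.coeff a * w.coeff b := by
  have hw : w = ∑ a ∈ w.support, C (w.coeff a) * X ^ a := as_sum_support_C_mul_X_pow w
  conv_lhs => rw [sq, hw, Finset.sum_mul]
  simp_rw [Finset.mul_sum]
  rw [map_sum]
  simp_rw [map_sum]
  refine Finset.sum_congr rfl fun a _ => Finset.sum_congr rfl fun b _ => ?_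
  have hmul : C (w.coeff a) * X ^ a * (C (w.coeff b) * X ^ b) = C (w.coeff a * w.coeff b) * X ^ (a + b) := by
    rw [map_mul, pow_add]; ring
  rw [hmul, lz_C_mul_X_pow]
  ring

/-- `L_z(Σ_{n<N} X^n) = Σ_{n<N} z(n)`. [folklore] -/
theorem lz_box (z : ℕ → ℂ) (N : ℕ) :
    (Polynomial.lsum (fun e : ℕ => (z e) • (LinearMap.id : ℂ →ₗ[ℂ] ℂ)) : ℂ[X] →ₗ[ℂ] ℂ)
        (∑ n ∈ range N, (X : ℂ[X]) ^ n) = ∑ n ∈ range N, z n := by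
  rw [map_sum]
  refine Finset.sum_congr rfl fun n _ => ?_
  have h := lz_C_mul_X_pow z 1 n
  rw [C_1, one_mul, mul_one] at h
  exact h

/-! ## The lower bound: every representation of the flat interval pattern has mass `≥ H_k / 8` -/

/-- **Flat interval patterns cost `Ω(log k)`.**  If `Σ_j c_j w_j² = Σ_{n<2k−1} X^n` with every `w_j`
supported in `[0,k)`, then `H_k = Σ_{n<k} 1/(n+1) ≤ 8 · Σ_j |c_j|‖w_j‖₂²`.  Proof: pair both sides with the
dual weight `z = 1/r_{[0,k)}` (`lz_*`): the right side gives `Σ_{n<2k−1} 1/r(n) ≥ H_k`, the left side is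
`Σ_j c_j w_jᵀ H(z) w_j` with `|w^T H(z) w| ≤ 8‖w‖²` (`hankel_inv_repr_norm_le`).  With `flat_rep`
(mass `≤ ⌊log₂ k⌋ + 5/2`) this pins `μ_{[0,k)}(𝟙) = Θ(log k)`. [folklore] -/
theorem flat_rep_mass_lower (k : ℕ) (s : ℕ) (c : Fin s → ℂ) (w : Fin s → ℂ[X])
    (hw : ∀ j, (w j).support ⊆ range k)
    (hsum : (∑ j, C (c j) * w j ^ 2) = ∑ n ∈ range (2 * k - 1), (X : ℂ[X]) ^ n) :
    (∑ n ∈ range k, 1 / ((n : ℝ) + 1)) ≤ 8 * ∑ j, sqMass (c j) (w j) := by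
  set z : ℕ → ℂ := fun n => (((min (n + 1) (2 * k - 1 - n) : ℕ) : ℂ))⁻¹ with hz
  have hL := congrArg
    (Polynomial.lsum (fun e : ℕ => (z e) • (LinearMap.id : ℂ →ₗ[ℂ] ℂ)) : ℂ[X] →ₗ[ℂ] ℂ) hsum
  rw [map_sum, lz_box] at hL
  have hterm : ∀ j, (Polynomial.lsum (fun e : ℕ => (z e) • (LinearMap.id : ℂ →ₗ[ℂ] ℂ)) : ℂ[X] →ₗ[ℂ] ℂ)
      (C (c j) * w j ^ 2) = c j * ∑ a ∈ (w j).support, ∑ b ∈ (w j).support,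
        z (a + b) * (w j).coeff a * (w j).coeff b := by
    intro j
    rw [← smul_eq_C_mul, map_smul, smul_eq_mul, lz_sq]
  simp_rw [hterm] at hL
  -- the right-hand side is a real sum `≥ H_k`
  have hR : (∑ n ∈ range k, 1 / ((n : ℝ) + 1)) ≤ ‖∑ n ∈ range (2 * k - 1), z n‖ := by
    have hreal : (∑ n ∈ range (2 * k - 1), z n) =
        ((∑ n ∈ range (2 * k - 1), (((min (n + 1) (2 * k - 1 - n) : ℕ) : ℝ))⁻¹ : ℝ) : ℂ) := by
      rw [Complex.ofReal_sum]
      refine Finset.sum_congr rfl fun n _ => ?_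
      rw [Complex.ofReal_inv, Complex.ofReal_natCast]
    rw [hreal, Complex.norm_real, Real.norm_of_nonneg (Finset.sum_nonneg fun n _ => by positivity)]
    have hsub : range k ⊆ range (2 * k - 1) := Finset.range_mono (by omega)
    refine le_trans (le_of_eq ?_) (Finset.sum_le_sum_of_subset_of_nonneg hsub fun n _ _ => by positivity)
    refine Finset.sum_congr rfl fun n hn => ?_
    have hn' := mem_range.1 hn
    rw [min_eq_left (by omega), one_div]
    push_cast
    ring
  -- the left-hand side is at most `8 · mass`
  have hQ : ∀ j, ‖∑ a ∈ (w j).support, ∑ b ∈ (w j).support, z (a + b) * (w j).coeff a * (w j).coeff b‖ ≤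
      8 * ∑ a ∈ (w j).support, ‖(w j).coeff a‖ ^ 2 := by
    intro j
    have hext : (∑ a ∈ (w j).support, ∑ b ∈ (w j).support, z (a + b) * (w j).coeff a * (w j).coeff b) =
        ∑ a ∈ range k, ∑ b ∈ range k, z (a + b) * (w j).coeff a * (w j).coeff b := by
      rw [Finset.sum_subset (hw j) (fun a _ ha => by
        rw [notMem_support_iff.1 ha]; simp)]
      refine Finset.sum_congr rfl fun a _ => ?_
      exact Finset.sum_subset (hw j) fun b _ hb => by rw [notMem_support_iff.1 hb]; simp
    have hext2 : (∑ a ∈ (w j).support, ‖(w j).coeff a‖ ^ 2) = ∑ a ∈ range k, ‖(w j).coeff a‖ ^ 2 :=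
      Finset.sum_subset (hw j) fun a _ ha => by rw [notMem_support_iff.1 ha]; simp
    rw [hext, hext2]
    exact hankel_inv_repr_norm_le k (fun a => (w j).coeff a)
  have hLn : ‖∑ j, c j * ∑ a ∈ (w j).support, ∑ b ∈ (w j).support,
      z (a + b) * (w j).coeff a * (w j).coeff b‖ ≤ 8 * ∑ j, sqMass (c j) (w j) := by
    refine (norm_sum_le _ _).trans ?_
    rw [Finset.mul_sum]
    refine Finset.sum_le_sum fun j _ => ?_
    rw [norm_mul]
    unfold sqMass
    calc ‖c j‖ * ‖∑ a ∈ (w j).support, ∑ b ∈ (w j).support, z (a + b) * (w j).coeff a * (w j).coeff b‖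
        ≤ ‖c j‖ * (8 * ∑ a ∈ (w j).support, ‖(w j).coeff a‖ ^ 2) :=
          mul_le_mul_of_nonneg_left (hQ j) (norm_nonneg _)
      _ = 8 * (‖c j‖ * ∑ a ∈ (w j).support, ‖(w j).coeff a‖ ^ 2) := by ring
  rw [hL] at hLn
  exact hR.trans hLn

/-- **Corollary: `log(k+1) ≤ 8 · mass`** for every representation of the flat pattern on `[0, 2k−1)` by
weighted squares supported in `[0,k)` (`log(k+1) ≤ H_k`, Mathlib `log_add_one_le_harmonic`). [folklore] -/
theorem flat_rep_mass_ge_log (k : ℕ) (s : ℕ) (c : Fin s → ℂ) (w : Fin s → ℂ[X])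
    (hw : ∀ j, (w j).support ⊆ range k)
    (hsum : (∑ j, C (c j) * w j ^ 2) = ∑ n ∈ range (2 * k - 1), (X : ℂ[X]) ^ n) :
    Real.log ((k : ℝ) + 1) ≤ 8 * ∑ j, sqMass (c j) (w j) := by
  have h := flat_rep_mass_lower k s c w hw hsum
  have hh := log_add_one_le_harmonic k
  have hcast : ((harmonic k : ℚ) : ℝ) = ∑ n ∈ range k, 1 / ((n : ℝ) + 1) := by
    simp [harmonic, one_div]
  push_cast at hh
  rw [hcast] at hh
  exact hh.trans h

end

end Summit.ValiantsHypothesis.ValiantsHypothesis.Theorems.FeketeSOSHardPaleyRIP
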